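import Summits.BirchSwinnertonDyer.BirchSwinnertonDyer.Theorems.AdditiveKolyvaginRoadRankLoweringReduction
import Summits.BirchSwinnertonDyer.BirchSwinnertonDyer.Theorems.AdditiveKolyvaginRoadLevelMembership
import Summits.BirchSwinnertonDyer.BirchSwinnertonDyer.Theorems.AdditiveKolyvaginRoadLocalEquiv
import Summits.BirchSwinnertonDyer.BirchSwinnertonDyer.Theorems.AdditiveKolyvaginRoadLocalDictionaries
import Summits.BirchSwinnertonDyer.BirchSwinnertonDyer.Theorems.AdditiveKolyvaginRoadEigen
import Summits.BirchSwinnertonDyer.Rank1Residual.X11b.KummerRelaxedStructures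
import Literature.NumberTheory.EllipticCurves.SelmerGaloisAction
import HarnessLib

/-!
# Route `AdditiveKolyvaginRoad`, crux `KolyvaginPrimitiveAdditive` (item stmt-BirchSwinnertonDyer-21400), stub J2
# (`stub_twoPrimeJumpAdditive`, skeleton v10): PRELIMINARIES for the two-prime jump — signs at detecting admissible
# primes, the eigen-decomposition under complex conjugation, and the `{v₁, v₂}`-relaxed Kummer group in the route's
# global currency (membership, `c`-stability, the level spaces `Sel_{q₁q₂}^μ`, `Sel_∅^μ` through it); the `¬ε`-half of J2
# (cell `pub/bsd-wall`, lead prover `bsd-wall-akr-p1` g5; `--supports stmt-BirchSwinnertonDyer-21400`, helper)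

WHAT. For `K` imaginary quadratic, complex conjugation `c`, Bertolini–Darmon admissible `q₁, q₂` with places `v₁, v₂`:
* §1 `exists_eigen_decomposition` — a `c`-stable subgroup of `H¹(K, E[p])` (`p` odd) splits elementwise into `±`-parts;
  `mem_torsionLocalKer_of_sign_ne` — if the `ε`-class `x` is detected at the place of an admissible `q`, every `¬ε`-class
  dies there (W. Zhang (9.2), akr-p1 g2 `localEquiv_of_admQ`).
* §2 places: `(q : 𝓞 K) ∈ 𝔭_w ⟺ w = v`; `c v = v`; distinct admissible primes have distinct places.
* §3 `R = kummerOutside E p {v₁, v₂}` (X11b: Kummer everywhere except `v₁, v₂`): membership in global currency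
  (`mem_kummerOutside_pair_iff`), `c`-stability (`conjAct_mem_kummerOutside_pair`: Kummer transport
  `conjAct_mem_selmerLocalKer_iff`), and the canonical spaces through it: `y ∈ Sel_{q₁q₂}^μ ⟺ c y = μ y ∧ y ∈ R ∧ y`
  toric at `v₁, v₂` (`mem_selQP_pair_iff`); `y ∈ Sel_∅^μ ⟺ c y = μ y ∧ y ∈ R ∧ y` Kummer at `v₁, v₂`
  (`mem_selQP_empty_iff_pair`).
* §4 `selQP_pair_not_eq` — CONJUNCT 2 of J2: `Sel_{q₁q₂}^{¬ε} = Sel_∅^{¬ε}` when both `q_i` detect an `ε`-class.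

HONEST FRAMING: theorems only; 0 definitions, 0 named facts, 0 `sorry`; no Poitou–Tate here; closes nothing.

References: [cite: WZhang2014, §5 (Sel_{𝔭_n}), §9 (9.2)] [cite: GrossLMS1991, §5 (5.1)] [cite: BertoliniDarmon2005, §2.3]
[cite: MilneADT2006, Ch. I §6 (6.5)].
-/

-- single-conjunct summit: `Summit.BirchSwinnertonDyer.BirchSwinnertonDyer.…` repeats the name by design
set_option linter.dupNamespace false

noncomputable section

open scoped Classical NumberField
open Function NumberField IsDedekindDomain Field WeierstrassCurve Module
open Literature.NumberTheory.EllipticCurves Literature.NumberTheory.EllipticCurves.ModularForms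
open Literature.NumberTheory.GaloisRepresentations Literature.NumberTheory.GaloisRepresentations.DiscreteGaloisModule
  Literature.NumberTheory.GaloisCohomology
open Summit.BirchSwinnertonDyer.Rank1Residual.X11b Literature.NumberTheory.Automorphic

namespace Summit.BirchSwinnertonDyer.BirchSwinnertonDyer.Theorems.AdditiveKoly

variable (W : WeierstrassCurve ℚ) (K : Type) [Field K] [NumberField K] (p : ℕ) (c : K ≃ₐ[ℚ] K)

/-! ## §1 Eigen-parts and signs -/

/-- **Eigen-decomposition of a `τ`-stable subgroup, `p` odd**: for an additive involution `τ` of `H¹(K, E[p])` and a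
`τ`-stable subgroup `A`, every `y ∈ A` is `y₁ + y₂` with `y_i ∈ A`, `τ y₁ = sgnP ε • y₁`, `τ y₂ = sgnP (¬ε) • y₂`
(`y₁ = u(y + ε τy)`, `y₂ = u(y − ε τy)`, `2u ≡ 1`). [cite: GrossLMS1991, §5 (5.1)] -/
theorem exists_eigen_decomposition (hp : Odd p) (τ : Vp W K p →+ Vp W K p) (hτ : ∀ x, τ (τ x) = x)
    (A : AddSubgroup (Vp W K p)) (hA : ∀ x ∈ A, τ x ∈ A) (ε : Bool) {y : Vp W K p} (hy : y ∈ A) :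
    ∃ y₁ ∈ A, ∃ y₂ ∈ A, τ y₁ = sgnP ε • y₁ ∧ τ y₂ = sgnP (!ε) • y₂ ∧ y₁ + y₂ = y := by
  obtain ⟨u, hu⟩ := exists_two_mul_zsmul_eq_of_odd W K p hp
  -- `m = u • y` has `m + m = y`; the symmetric and antisymmetric parts of `m`
  have hmm : u • y + u • y = y := by rw [← add_zsmul, ← two_mul, hu]
  have hm : u • y ∈ A := A.zsmul_mem hy u
  have hτm : τ (u • y) ∈ A := hA _ hm
  have hplus : τ (u • y + τ (u • y)) = sgnP true • (u • y + τ (u • y)) := by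
    rw [map_add, hτ, show sgnP true = 1 from rfl, one_zsmul, add_comm]
  have hminus : τ (u • y - τ (u • y)) = sgnP false • (u • y - τ (u • y)) := by
    rw [map_sub, hτ, show sgnP false = -1 from rfl, neg_one_zsmul, neg_sub]
  cases ε
  · refine ⟨u • y - τ (u • y), A.sub_mem hm hτm, u • y + τ (u • y), A.add_mem hm hτm, hminus, hplus, ?_⟩
    rw [show u • y - τ (u • y) + (u • y + τ (u • y)) = u • y + u • y by abel, hmm]
  · refine ⟨u • y + τ (u • y), A.add_mem hm hτm, u • y - τ (u • y), A.sub_mem hm hτm, hplus, hminus, ?_⟩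
    rw [show u • y + τ (u • y) + (u • y - τ (u • y)) = u • y + u • y by abel, hmm]

/-- **A class of the wrong sign dies at a detecting admissible place** (W. Zhang (9.2)): if the `ε`-class `x` is NOT
locally trivial at the place `v` of the admissible `q`, then the sign of `q` is `ε` (akr-p1 g2 `localEquiv_of_admQ`) and
every `¬ε`-class is locally trivial at `v`. [cite: WZhang2014, §9 (9.2)] -/
theorem mem_torsionLocalKer_of_sign_ne [W.IsElliptic] [W.IsGloballyMinimal] [Fact p.Prime] (hp : Odd p)
    (hK2 : Module.finrank ℚ K = 2) (hc1 : c ≠ 1) (q : AdmQ W K p) (v : HeightOneSpectrum (𝓞 K))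
    (hqv : ((q : ℕ) : 𝓞 K) ∈ v.asIdeal) {ε : Bool} {x : Vp W K p} (hx : conjAct W c ((p ^ 1 : ℕ) : ℤ) x = sgnP ε • x)
    (hdet : x ∉ (W.baseChange K).torsionLocalKer (v.adicCompletion K) ((p ^ 1 : ℕ) : ℤ))
    {y : Vp W K p} (hy : conjAct W c ((p ^ 1 : ℕ) : ℤ) y = sgnP (!ε) • y) :
    y ∈ (W.baseChange K).torsionLocalKer (v.adicCompletion K) ((p ^ 1 : ℕ) : ℤ) := by
  set lm := (W.baseChange K).torsionLocMap (v.adicCompletion K) ((p ^ 1 : ℕ) : ℤ) with hlm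
  have hNloc : ∀ z : Vp W K p, ((p ^ 1 : ℕ) : ℤ) • lm z = 0 := fun z ↦ zsmul_discreteH1_torsion _ (lm z)
  have hNodd : Odd ((p ^ 1 : ℕ) : ℤ) := by rw [pow_one]; exact_mod_cast hp
  obtain ⟨s, hs⟩ := localEquiv_of_admQ W K p hK2 hc1 q
  have hsv : ∀ z, lm (conjAct W c ((p ^ 1 : ℕ) : ℤ) z) = sgnP s • lm z := hs v hqv
  have hsε : s = ε := by
    by_contra hne
    exact hdet (loc_eq_zero_of_sign_ne_odd _ lm hsv hx hne hNodd (hNloc x))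
  exact loc_eq_zero_of_sign_ne_odd _ lm hsv hy (by rw [hsε]; cases ε <;> decide) hNodd (hNloc y)

/-! ## §2 Places of admissible primes -/

variable [W.IsGloballyMinimal]

/-- Places above an admissible (inert) prime: `(q : 𝓞 K) ∈ 𝔭_w ⟺ w = v` (a non-zero prime of a Dedekind domain is
maximal). [folklore] -/
theorem mem_asIdeal_iff_eq_of_admQ (q : AdmQ W K p) (v : HeightOneSpectrum (𝓞 K)) (hv : ((q : ℕ) : 𝓞 K) ∈ v.asIdeal)
    (w : HeightOneSpectrum (𝓞 K)) : ((q : ℕ) : 𝓞 K) ∈ w.asIdeal ↔ w = v := by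
  have hq0 : (q : ℕ) ≠ 0 := q.2.1.ne_zero
  have hqP : (Ideal.span {((q : ℕ) : 𝓞 K)}).IsPrime := q.2.2.2.1
  have hspan : ∀ w : HeightOneSpectrum (𝓞 K), ((q : ℕ) : 𝓞 K) ∈ w.asIdeal →
      w.asIdeal = Ideal.span {((q : ℕ) : 𝓞 K)} := fun w hw ↦ by
    have hle : Ideal.span {((q : ℕ) : 𝓞 K)} ≤ w.asIdeal := by
      rw [Ideal.span_le, Set.singleton_subset_iff]; exact hw
    have hne : Ideal.span {((q : ℕ) : 𝓞 K)} ≠ ⊥ := by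
      rw [Ne, Ideal.span_singleton_eq_bot]; exact_mod_cast hq0
    exact ((hqP.isMaximal hne).eq_of_le w.isPrime.ne_top hle).symm
  exact ⟨fun hw ↦ HeightOneSpectrum.ext (by rw [hspan v hv, hspan w hw]), fun h ↦ h ▸ hv⟩

/-- **The place above an admissible prime is fixed by every automorphism of `K`.** [folklore] -/
theorem smul_place_eq_of_admQ (q : AdmQ W K p) (v : HeightOneSpectrum (𝓞 K)) (hv : ((q : ℕ) : 𝓞 K) ∈ v.asIdeal)
    (σ : K ≃ₐ[ℚ] K) : σ • v = v := by
  refine (mem_asIdeal_iff_eq_of_admQ W K p q v hv (σ • v)).mp ?_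
  have h := (Literature.NumberTheory.Automorphic.HeightOneSpectrum.smul_mem_smul_asIdeal_iff σ v ((q : ℕ) : 𝓞 K)).mpr hv
  rwa [show σ • ((q : ℕ) : 𝓞 K) = ((q : ℕ) : 𝓞 K) from map_natCast (MulSemiringAction.toRingHom _ _ σ) q] at h

omit [NumberField K] in
/-- Two distinct admissible primes have distinct places. [folklore] -/
theorem place_ne_of_admQ_ne {q₁ q₂ : AdmQ W K p} (hq : q₁ ≠ q₂) {v₁ v₂ : HeightOneSpectrum (𝓞 K)}
    (hv₁ : ((q₁ : ℕ) : 𝓞 K) ∈ v₁.asIdeal) (hv₂ : ((q₂ : ℕ) : 𝓞 K) ∈ v₂.asIdeal) : v₁ ≠ v₂ := by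
  intro h
  have h2 : ((q₂ : ℕ) : 𝓞 K) ∈ v₁.asIdeal := h ▸ hv₂
  have hcop : IsCoprime ((q₁ : ℕ) : ℤ) ((q₂ : ℕ) : ℤ) :=
    Nat.isCoprime_iff_coprime.mpr ((Nat.coprime_primes q₁.2.1 q₂.2.1).mpr (fun h' ↦ hq (Subtype.ext h')))
  obtain ⟨a, b, hab⟩ := hcop
  have hab' := congrArg (fun z : ℤ ↦ (z : 𝓞 K)) hab
  push_cast at hab'
  apply v₁.isPrime.ne_top
  rw [Ideal.eq_top_iff_one, ← hab']
  exact v₁.asIdeal.add_mem (v₁.asIdeal.mul_mem_left _ hv₁) (v₁.asIdeal.mul_mem_left _ h2)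

/-! ## §3 The `{v₁, v₂}`-relaxed Kummer group in global currency -/

omit [W.IsGloballyMinimal] in
/-- **Membership in the `{v₁, v₂}`-relaxed Kummer group in global currency**: `y ∈ kummerOutside E p {v₁, v₂}` iff `y`
satisfies E's Kummer condition at every infinite place and at every finite place `w ≠ v₁, v₂`. [cite: MilneADT2006,
Ch. I §6 (6.5)] -/
theorem mem_kummerOutside_pair_iff (v₁ v₂ : HeightOneSpectrum (𝓞 K)) (y : Vp W K p) :
    y ∈ kummerOutside (W.baseChange K) (p ^ 1) ({Sum.inr v₁, Sum.inr v₂} : Finset (Place K)) ↔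
      (∀ w : InfinitePlace K, y ∈ selmerLocalKer (W.baseChange K) w.Completion ((p ^ 1 : ℕ) : ℤ)) ∧
      (∀ w : HeightOneSpectrum (𝓞 K), w ≠ v₁ → w ≠ v₂ →
        y ∈ selmerLocalKer (W.baseChange K) (w.adicCompletion K) ((p ^ 1 : ℕ) : ℤ)) := by
  refine Iff.trans (mem_kummerOutside_iff (W.baseChange K) (p ^ 1) _ y) ?_
  constructor
  · intro h
    refine ⟨fun w ↦ ?_, fun w hw₁ hw₂ ↦ ?_⟩
    · rw [mem_selmerLocalKer_iff_localization_mem_kummer_inf_P]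
      exact h (Sum.inl w) (by simp)
    · rw [mem_selmerLocalKer_iff_localization_mem_kummer_P]
      exact h (Sum.inr w) (by simp [hw₁, hw₂])
  · rintro ⟨hinf, hfin⟩ v hv
    rcases v with w | w
    · exact (mem_selmerLocalKer_iff_localization_mem_kummer_inf_P W K p w y).mp (hinf w)
    · have hw : w ≠ v₁ ∧ w ≠ v₂ := by simpa [not_or] using hv
      exact (mem_selmerLocalKer_iff_localization_mem_kummer_P W K p w y).mp (hfin w hw.1 hw.2)

/-- **The `{v₁, v₂}`-relaxed Kummer group is stable under complex conjugation** (`K` imaginary quadratic, `v₁, v₂` the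
places of admissible primes): `c` fixes `v₁, v₂` and transports the Kummer condition at `c⁻¹ w` to the one at `w`
(tree `conjAct_mem_selmerLocalKer_iff`, `galAdicCompletionEquiv`); the conditions at the complex places are empty.
[cite: GrossLMS1991, §5 (5.1)] -/
theorem conjAct_mem_kummerOutside_pair (hK : IsImaginaryQuadratic K) (q₁ q₂ : AdmQ W K p)
    (v₁ v₂ : HeightOneSpectrum (𝓞 K)) (hv₁ : ((q₁ : ℕ) : 𝓞 K) ∈ v₁.asIdeal) (hv₂ : ((q₂ : ℕ) : 𝓞 K) ∈ v₂.asIdeal)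
    {y : Vp W K p} (hy : y ∈ kummerOutside (W.baseChange K) (p ^ 1) ({Sum.inr v₁, Sum.inr v₂} : Finset (Place K))) :
    conjAct W c ((p ^ 1 : ℕ) : ℤ) y ∈
      kummerOutside (W.baseChange K) (p ^ 1) ({Sum.inr v₁, Sum.inr v₂} : Finset (Place K)) := by
  rw [mem_kummerOutside_pair_iff] at hy ⊢
  obtain ⟨-, hfin⟩ := hy
  refine ⟨fun w ↦ ?_, fun w hw₁ hw₂ ↦ ?_⟩
  · haveI : IsAlgClosed w.Completion :=
      isAlgClosed_of_ringEquiv (InfinitePlace.Completion.ringEquivComplexOfIsComplex (hK.2.isComplex w)).symm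
    rw [WeierstrassCurve.selmerLocalKer_eq_top_of_isAlgClosed]
    trivial
  · have h : c • (c⁻¹ • w) = w := smul_inv_smul c w
    haveI : CharZero ((c⁻¹ • w).adicCompletion K) := charZero_of_injective_algebraMap (algebraMap K _).injective
    haveI : CharZero (w.adicCompletion K) := charZero_of_injective_algebraMap (algebraMap K _).injective
    refine (conjAct_mem_selmerLocalKer_iff W c (galAdicCompletionEquiv (L := K) c h)
      (isSemilinearRingEquiv_galAdicCompletionEquiv c h) _ y).mpr (hfin _ ?_ ?_)
    · intro h1
      exact hw₁ (by rw [← h, h1, smul_place_eq_of_admQ W K p q₁ v₁ hv₁ c])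
    · intro h2
      exact hw₂ (by rw [← h, h2, smul_place_eq_of_admQ W K p q₂ v₂ hv₂ c])

/-- **`Sel_{q₁q₂}^μ` through `R`**: `y ∈ SelQP {q₁, q₂} μ` iff `c y = sgnP μ • y`, `y ∈ kummerOutside E p {v₁, v₂}` and `y` is
TORIC at `v₁` and at `v₂` (the places above `q_i` being `v_i` only). [cite: WZhang2014, §5 (Sel_{𝔭_n})] -/
theorem mem_selQP_pair_iff [Module (ZMod p) (Vp W K p)] (q₁ q₂ : AdmQ W K p) (v₁ v₂ : HeightOneSpectrum (𝓞 K))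
    (hv₁ : ((q₁ : ℕ) : 𝓞 K) ∈ v₁.asIdeal) (hv₂ : ((q₂ : ℕ) : 𝓞 K) ∈ v₂.asIdeal) (μ : Bool) (y : Vp W K p) :
    y ∈ SelQP W K p c {q₁, q₂} μ ↔
      conjAct W c ((p ^ 1 : ℕ) : ℤ) y = sgnP μ • y ∧
      y ∈ kummerOutside (W.baseChange K) (p ^ 1) ({Sum.inr v₁, Sum.inr v₂} : Finset (Place K)) ∧
      y ∈ toricLocalKer (W.baseChange K) (v₁.adicCompletion K) ((p ^ 1 : ℕ) : ℤ) ∧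
      y ∈ toricLocalKer (W.baseChange K) (v₂.adicCompletion K) ((p ^ 1 : ℕ) : ℤ) := by
  have huniq₁ := mem_asIdeal_iff_eq_of_admQ W K p q₁ v₁ hv₁
  have huniq₂ := mem_asIdeal_iff_eq_of_admQ W K p q₂ v₂ hv₂
  rw [mem_selQP_iff, mem_kummerOutside_pair_iff]
  constructor
  · rintro ⟨h1, h2, h3, h4⟩
    refine ⟨h1, ⟨h2, fun w hw₁ hw₂ ↦ h3 w fun q hq ↦ ?_⟩, ?_, ?_⟩
    · rcases Finset.mem_insert.mp hq with rfl | hq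
      · exact fun h ↦ hw₁ ((huniq₁ w).mp h)
      · rw [Finset.mem_singleton] at hq; subst hq
        exact fun h ↦ hw₂ ((huniq₂ w).mp h)
    · exact h4 q₁ (Finset.mem_insert_self _ _) v₁ hv₁
    · exact h4 q₂ (Finset.mem_insert_of_mem (Finset.mem_singleton_self _)) v₂ hv₂
  · rintro ⟨h1, ⟨h2, h3⟩, h4, h5⟩
    refine ⟨h1, h2, fun w hw ↦ h3 w (fun h ↦ hw q₁ (Finset.mem_insert_self _ _) (h ▸ hv₁))
      (fun h ↦ hw q₂ (Finset.mem_insert_of_mem (Finset.mem_singleton_self _)) (h ▸ hv₂)), fun q hq w hw ↦ ?_⟩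
    rcases Finset.mem_insert.mp hq with rfl | hq
    · rw [(huniq₁ w).mp hw]; exact h4
    · rw [Finset.mem_singleton] at hq; subst hq
      rw [(huniq₂ w).mp hw]; exact h5

/-- **`Sel_∅^μ` through `R`**: `y ∈ SelQP ∅ μ` iff `c y = sgnP μ • y`, `y ∈ kummerOutside E p {v₁, v₂}` and `y` is KUMMER at
`v₁` and at `v₂`. [cite: WZhang2014, §5 (Sel_{𝔭_n} at n = 1)] -/
theorem mem_selQP_empty_iff_pair [Module (ZMod p) (Vp W K p)] (v₁ v₂ : HeightOneSpectrum (𝓞 K))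
    (μ : Bool) (y : Vp W K p) :
    y ∈ SelQP W K p c ∅ μ ↔
      conjAct W c ((p ^ 1 : ℕ) : ℤ) y = sgnP μ • y ∧
      y ∈ kummerOutside (W.baseChange K) (p ^ 1) ({Sum.inr v₁, Sum.inr v₂} : Finset (Place K)) ∧
      y ∈ selmerLocalKer (W.baseChange K) (v₁.adicCompletion K) ((p ^ 1 : ℕ) : ℤ) ∧
      y ∈ selmerLocalKer (W.baseChange K) (v₂.adicCompletion K) ((p ^ 1 : ℕ) : ℤ) := by
  rw [mem_selQP_empty_iff, mem_kummerOutside_pair_iff, WeierstrassCurve.mem_selmerGroup_iff]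
  constructor
  · rintro ⟨h1, hfin, hinf⟩
    exact ⟨h1, ⟨hinf, fun w _ _ ↦ hfin w⟩, hfin v₁, hfin v₂⟩
  · rintro ⟨h1, ⟨hinf, hfin⟩, h₁, h₂⟩
    refine ⟨h1, fun w ↦ ?_, hinf⟩
    by_cases hw₁ : w = v₁
    · subst hw₁; exact h₁
    by_cases hw₂ : w = v₂
    · subst hw₂; exact h₂
    exact hfin w hw₁ hw₂

omit [W.IsGloballyMinimal] in
/-- Locally trivial classes are Kummer and toric. [cite: BertoliniDarmon2005, §2.2] -/
theorem kummer_and_toric_of_mem_torsionLocalKer (v : HeightOneSpectrum (𝓞 K)) {y : Vp W K p}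
    (hy : y ∈ (W.baseChange K).torsionLocalKer (v.adicCompletion K) ((p ^ 1 : ℕ) : ℤ)) :
    y ∈ selmerLocalKer (W.baseChange K) (v.adicCompletion K) ((p ^ 1 : ℕ) : ℤ) ∧
      y ∈ toricLocalKer (W.baseChange K) (v.adicCompletion K) ((p ^ 1 : ℕ) : ℤ) :=
  ⟨(W.baseChange K).torsionLocalKer_le_selmerLocalKer (v.adicCompletion K) _ hy, torsionLocalKer_le_toricLocalKer W K _ _ hy⟩

/-! ## §4 Conjunct 2 of J2: the `¬ε`-side is untouched -/

/-- **`Sel_{q₁q₂}^{¬ε} = Sel_∅^{¬ε}` when `q₁, q₂` both detect an `ε`-class `x`** (`K` quadratic, `c ≠ 1`, `p` odd): the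
sign of each `q_i` is `ε`, so every `¬ε`-class is locally trivial at `v₁, v₂`, hence both Kummer and toric there; away from
`v₁, v₂` the two spaces have the same conditions. [cite: WZhang2014, Lemma 5.3 (2), §9 (9.2)] -/
theorem selQP_pair_not_eq [W.IsElliptic] [Fact p.Prime] [Module (ZMod p) (Vp W K p)] (hp : Odd p)
    (hK2 : Module.finrank ℚ K = 2) (hc1 : c ≠ 1) (q₁ q₂ : AdmQ W K p) (v₁ v₂ : HeightOneSpectrum (𝓞 K))
    (hv₁ : ((q₁ : ℕ) : 𝓞 K) ∈ v₁.asIdeal) (hv₂ : ((q₂ : ℕ) : 𝓞 K) ∈ v₂.asIdeal) {ε : Bool} {x : Vp W K p}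
    (hx : conjAct W c ((p ^ 1 : ℕ) : ℤ) x = sgnP ε • x)
    (hdet₁ : x ∉ (W.baseChange K).torsionLocalKer (v₁.adicCompletion K) ((p ^ 1 : ℕ) : ℤ))
    (hdet₂ : x ∉ (W.baseChange K).torsionLocalKer (v₂.adicCompletion K) ((p ^ 1 : ℕ) : ℤ)) :
    SelQP W K p c {q₁, q₂} (!ε) = SelQP W K p c ∅ (!ε) := by
  ext y
  rw [mem_selQP_pair_iff W K p c q₁ q₂ v₁ v₂ hv₁ hv₂, mem_selQP_empty_iff_pair W K p c v₁ v₂]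
  constructor
  · rintro ⟨h1, h2, -, -⟩
    exact ⟨h1, h2,
      (kummer_and_toric_of_mem_torsionLocalKer W K p v₁
        (mem_torsionLocalKer_of_sign_ne W K p c hp hK2 hc1 q₁ v₁ hv₁ hx hdet₁ h1)).1,
      (kummer_and_toric_of_mem_torsionLocalKer W K p v₂
        (mem_torsionLocalKer_of_sign_ne W K p c hp hK2 hc1 q₂ v₂ hv₂ hx hdet₂ h1)).1⟩
  · rintro ⟨h1, h2, -, -⟩
    exact ⟨h1, h2,
      (kummer_and_toric_of_mem_torsionLocalKer W K p v₁
        (mem_torsionLocalKer_of_sign_ne W K p c hp hK2 hc1 q₁ v₁ hv₁ hx hdet₁ h1)).2,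
      (kummer_and_toric_of_mem_torsionLocalKer W K p v₂
        (mem_torsionLocalKer_of_sign_ne W K p c hp hK2 hc1 q₂ v₂ hv₂ hx hdet₂ h1)).2⟩

end Summit.BirchSwinnertonDyer.BirchSwinnertonDyer.Theorems.AdditiveKoly

end
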